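import Mathlib
import HarnessLib
import Summits.ResolutionOfSingularities.ResolutionOfSingularities.Theorems.WildQuotientsWildQuotientResolutionS1aKillFreeRootKill

/-!
# S1a — K-FREE FRAME: a `k`-SHOT KILL (a master tree all of whose leaves have EMPTY carried formal locus) discharges the stub's conclusion

[OURS · L1 W4.5c · lead-1 g12; plan-1 A-KF v1 §1.3/§1.4 (S1) «leaves by (F-T0)», R-F15c (I-2 := MT-a1″: depth 3, ALL leaves killed), X-CERT v1 §2
(a1: 3 moves, 7 charts, all killed; D₄: depth 4)] — NOT statements of the manuscript; counted 0; AI-level work, weaker than expert review. Crux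
stmt-ResolutionOfSingularities-17941 `CyclicQuotientFourfolds`, line `s1a-logminvertex` v13 (`stub_reachLowerInFX`).

The multi-move form of `exists_reachLowerF_of_oneShotKill` (✓p660021):
* `KillsIn n M` (OURS, research bookkeeping): from the model `M` there is a tree of `n` successive admissible MOVES (each level quantified over ALL
  realisations, each realisation carrying some node atlas) all of whose depth-`n` realisations carry an atlas with EMPTY formal locus;
* ★★ `exists_reachLowerF_of_killsIn` — if `KillsIn (n+1) M₀` and every model of the datum has a Noetherian base, then for EVERY root decoration `𝔄₀` the
  conclusion of `ReachLowerInF(X)` holds at `(M₀, 𝔄₀)`: the class `P := {F = ∅} ∪ {KillsIn (m+1)}` with, from every non-terminal member, the kill tree itself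
  (leaves by (F-T0) `lexLTF_of_fLocus_eq_empty`, intermediate nodes in `P` because `KillsIn` descends to realisations); `exists_reachLowerF_of_killsIn_datum`.
So an X-scheme instance (I-2, I-3, …) only has to prove `KillsIn n (initial)` — a nested ∃∀ statement in which the producer nodes of the successive moves stay
INTERNAL to one proof (no node-exporting interfaces).
-/

set_option linter.dupNamespace false

noncomputable section

open CategoryTheory Limits AlgebraicGeometry TopologicalSpace Topology
open Literature.AlgebraicGeometry.Resolution Literature.AlgebraicGeometry.RelativeSpec
open Summit.ResolutionOfSingularities.ResolutionOfSingularities.Theorems.WildQuotientResolution.S1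
open Summit.ResolutionOfSingularities.ResolutionOfSingularities.Theorems.WildQuotientResolution.S1.NodeAtlas
open Summit.ResolutionOfSingularities.ResolutionOfSingularities.Theorems.WildQuotientResolution.S1.NpFrame

namespace Summit.ResolutionOfSingularities.ResolutionOfSingularities.Theorems.WildQuotientResolution.S1.GameFrame.GModel

variable {p : ℕ} {X' X₁ : Scheme.{0}} {q : X' ⟶ X₁} {G : Type} [Group G] {ρ : G →* Aut X'} {g₀ : G}

/-- **`KillsIn n M`** (OURS, bookkeeping): an `n`-move kill tree from `M` — `n = 0`: some node atlas on `M` has empty carried formal locus; `n + 1`: some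
admissible centre on `M` all of whose realisations carry a node atlas and satisfy `KillsIn n`. [OURS · L1 W4.5c · X-scheme master trees] -/
def KillsIn : ℕ → GModel p q G ρ g₀ → Prop
  | 0, M => ∃ 𝔄 : NodeAtlasData p M.act g₀, 𝔄.fLocus = ∅
  | n + 1, M => ∃ (𝒦 : ReesFiltration M.V) (d : ℕ), IsAdmissibleCentre p M.act g₀ 𝒦 d ∧
      ∀ M' : GModel p q G ρ g₀, M.IsMoveOf M' 𝒦 d → Nonempty (NodeAtlasData p M'.act g₀) ∧ KillsIn n M'

/-- Unfolding `KillsIn 0`. -/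
theorem killsIn_zero_iff (M : GModel p q G ρ g₀) : KillsIn 0 M ↔ ∃ 𝔄 : NodeAtlasData p M.act g₀, 𝔄.fLocus = ∅ := Iff.rfl

/-- Unfolding `KillsIn (n + 1)`. -/
theorem killsIn_succ_iff (n : ℕ) (M : GModel p q G ρ g₀) : KillsIn (n + 1) M ↔ ∃ (𝒦 : ReesFiltration M.V) (d : ℕ), IsAdmissibleCentre p M.act g₀ 𝒦 d ∧
    ∀ M' : GModel p q G ρ g₀, M.IsMoveOf M' 𝒦 d → Nonempty (NodeAtlasData p M'.act g₀) ∧ KillsIn n M' := Iff.rfl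

/-- The kill tree from `M` is a `TreeF` of the same depth inside `P := {F = ∅} ∪ {KillsIn (m+1)}`, with leaves below any decorated model whose carried formal
locus is non-empty. -/
theorem treeF_of_killsIn (R : GModel p q G ρ g₀) (𝔄R : NodeAtlasData p R.act g₀) (hR : 𝔄R.fLocus.Nonempty) :
    ∀ (n : ℕ) (M : GModel p q G ρ g₀) (𝔄 : NodeAtlasData p M.act g₀), KillsIn (n + 1) M →
      TreeF (fun N 𝔅 => 𝔅.fLocus = ∅ ∨ ∃ m : ℕ, KillsIn (m + 1) N) (fun N 𝔅 => LexLTF N 𝔅 R 𝔄R) (n + 1) M 𝔄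
  | 0, M, 𝔄, h => by
      obtain ⟨𝒦, d, hadm, hmv⟩ := h
      refine Or.inr (Or.inr ⟨𝒦, d, hadm, fun M' hm => ?_⟩)
      obtain ⟨-, 𝔄', h𝔄'⟩ := hmv M' hm
      exact ⟨𝔄', Or.inl h𝔄', M'.lexLTF_of_fLocus_eq_empty 𝔄' R 𝔄R h𝔄' hR⟩
  | n + 1, M, 𝔄, h => by
      obtain ⟨𝒦, d, hadm, hmv⟩ := h
      refine Or.inr (Or.inr ⟨𝒦, d, hadm, fun M' hm => ?_⟩)
      obtain ⟨⟨𝔄'⟩, h'⟩ := hmv M' hm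
      exact ⟨𝔄', Or.inr ⟨n, h'⟩, treeF_of_killsIn R 𝔄R hR n M' 𝔄' h'⟩

/-- ★★ **A `k`-SHOT KILL DISCHARGES THE STUB'S CONCLUSION, for every root decoration.** If `KillsIn (n+1) M₀` and every model of the datum has a Noetherian
base, then for every node atlas `𝔄₀` on `M₀` there is a class `P ∋ (M₀, 𝔄₀)` of decorated models from every non-terminal member of which a bounded
`TreeF` inside `P` reaches `μ_F`-lower decorated models. [OURS · L1 W4.5c · X-scheme; NOT a statement of the manuscript] -/
theorem exists_reachLowerF_of_killsIn [Finite G] (hp : p.Prime) (hG : ∀ g : G, g ∈ Subgroup.zpowers g₀)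
    (hNB : ∀ M : GModel p q G ρ g₀, M.HasNoetherianBase) (M₀ : GModel p q G ρ g₀) (𝔄₀ : NodeAtlasData p M₀.act g₀) {n : ℕ} (h : KillsIn (n + 1) M₀) :
    ∃ P : ∀ M : GModel p q G ρ g₀, NodeAtlasData p M.act g₀ → Prop,
      P M₀ 𝔄₀ ∧ ∀ (M : GModel p q G ρ g₀) (𝔄 : NodeAtlasData p M.act g₀), P M 𝔄 → ¬ M.Terminal →
        ∃ n : ℕ, TreeF P (fun N 𝔅 => LexLTF N 𝔅 M 𝔄) n M 𝔄 := by
  refine ⟨fun M 𝔄 => 𝔄.fLocus = ∅ ∨ ∃ m : ℕ, KillsIn (m + 1) M, Or.inr ⟨n, h⟩, ?_⟩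
  rintro M 𝔄 hP hT
  have hne : 𝔄.fLocus.Nonempty := by
    rw [Set.nonempty_iff_ne_empty]
    exact fun h => hT (GModelBridge.terminal_of_fLocus_eq_empty hG hp M (hNB M) 𝔄 h)
  rcases hP with h | ⟨m, hm⟩
  · exact absurd h hne.ne_empty
  · exact ⟨m + 1, treeF_of_killsIn M 𝔄 hne m M 𝔄 hm⟩

/-- **The datum form** (`hasNoetherianBase_of_datum`). [OURS · L1 W4.5c] -/
theorem exists_reachLowerF_of_killsIn_datum [Finite G] (hp : p.Prime) (hG : ∀ g : G, g ∈ Subgroup.zpowers g₀)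
    {k : Type} [Field k] (f : X₁ ⟶ Spec (.of k)) [LocallyOfFiniteType f] [IsFinite q]
    (M₀ : GModel p q G ρ g₀) (𝔄₀ : NodeAtlasData p M₀.act g₀) {n : ℕ} (h : KillsIn (n + 1) M₀) :
    ∃ P : ∀ M : GModel p q G ρ g₀, NodeAtlasData p M.act g₀ → Prop,
      P M₀ 𝔄₀ ∧ ∀ (M : GModel p q G ρ g₀) (𝔄 : NodeAtlasData p M.act g₀), P M 𝔄 → ¬ M.Terminal →
        ∃ n : ℕ, TreeF P (fun N 𝔅 => LexLTF N 𝔅 M 𝔄) n M 𝔄 :=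
  exists_reachLowerF_of_killsIn hp hG (hasNoetherianBase_of_datum f) M₀ 𝔄₀ h

end Summit.ResolutionOfSingularities.ResolutionOfSingularities.Theorems.WildQuotientResolution.S1.GameFrame.GModel

end
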